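import Summits.PneNP.PneNP.Theorems.DelsarteLasserreCodeSizeVerifier
import Literature.Computability.Complexity.NEXPCertificates
import Literature.Computability.Complexity.PRelHierarchy
import Literature.Computability.Complexity.PromiseProofs

/-!
# Route DelsarteLasserre — `CodeSizeLangInNEXP` (stmt-PneNP-2130)

Frame fact F1: the code-size language `L_code = {⟨1ⁿ, ⟨1ᵈ, u⟩⟩ : bitsToNat u ≤ A(n, d)}` (`A(n, d)` = the independence number
of the "distance `< d`" graph on `{0,1}ⁿ`) is in `NEXP`, by `mem_NEXP_of_certificates`: the certificate lists
`K = bitsToNat u` codewords as consecutive `n`-bit blocks (padded by `K` bits, so that `K ≤ |y|` also when `n = 0`), of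
length `K(n + 1) ≤ 4ⁿ ≤ 2^{|x|}`; the polynomial-time matrix is the typed test of `DelsarteLasserreCodeSizeVerifier`
(`R := g ⁻¹' HeadIs true ∈ P`). Soundness: the `K` blocks are pairwise distinct words at Hamming distance `≥ d`, an
independent `K`-set (`IsIndepSet.card_le_indepNum`); completeness: list `K` elements of a maximum independent set.
-/

set_option linter.dupNamespace false -- `Summit.PneNP.PneNP.…`: summit = sub-problem name (D-0017 single-conjunct layout)

namespace Summit.PneNP.PneNP.Theorems

open _root_.Computability
open Literature.Computability.Complexity Literature.Computability.Complexity.CodeFP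
  Literature.Computability.Complexity.Brick

/-- List sums over `range n` are `Finset` sums. [folklore] -/
theorem delsarteLasserre_sum_map_range (f : ℕ → ℕ) : ∀ n : ℕ, ((List.range n).map f).sum = ∑ l ∈ Finset.range n, f l
  | 0 => rfl
  | n + 1 => by
    rw [List.range_succ, List.map_append, List.sum_append, List.map_singleton, List.sum_singleton,
      Finset.sum_range_succ, delsarteLasserre_sum_map_range f n]

/-- **The differing-position count is the Hamming distance** of the `n`-bit words read off two blocks. [folklore] -/
theorem delsarteLasserre_count_eq_hammingDist (n : ℕ) (b₁ b₂ : List Bool) :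
    ((List.range n).map fun l => if b₁.getD l false = b₂.getD l false then 0 else 1).sum =
      hammingDist (fun l : Fin n => b₁.getD l false) (fun l : Fin n => b₂.getD l false) := by
  rw [hammingDist, Finset.card_filter, delsarteLasserre_sum_map_range,
    ← Fin.sum_univ_eq_sum_range (fun l => if b₁.getD l false = b₂.getD l false then 0 else 1) n]
  refine Finset.sum_congr rfl fun l _ => ?_
  by_cases h : b₁.getD l false = b₂.getD l false
  · rw [if_pos h, if_neg (not_not.2 h)]
  · rw [if_neg h, if_pos h]

/-- Length of the concatenation of `n`-bit words. [folklore] -/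
theorem delsarteLasserre_length_flatten {n : ℕ} : ∀ L : List (Fin n → Bool),
    ((L.map fun w => List.ofFn w).flatten).length = L.length * n
  | [] => by simp
  | w :: L => by
    rw [List.map_cons, List.flatten_cons, List.length_append, List.length_ofFn, delsarteLasserre_length_flatten L,
      List.length_cons]
    ring

/-- The `i`-th block of the concatenation of `n`-bit words is the `i`-th word. [folklore] -/
theorem delsarteLasserre_block_flatten {n : ℕ} (pad : List Bool) : ∀ (L : List (Fin n → Bool)) (i : ℕ) (hi : i < L.length),
    ((((L.map fun w => List.ofFn w).flatten) ++ pad).drop (i * n)).take n = List.ofFn (L[i])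
  | [], i, hi => absurd hi (Nat.not_lt_zero _)
  | w :: L, 0, _ => by
    rw [List.map_cons, List.flatten_cons, zero_mul, List.drop_zero, List.append_assoc, List.getElem_cons_zero]
    exact List.take_left' (List.length_ofFn ..)
  | w :: L, i + 1, hi => by
    rw [List.map_cons, List.flatten_cons, List.append_assoc, List.drop_append, List.length_ofFn,
      List.drop_eq_nil_of_le (by rw [List.length_ofFn]; nlinarith), List.nil_append,
      show (i + 1) * n - n = i * n by rw [Nat.succ_mul, Nat.add_sub_cancel], List.getElem_cons_succ]
    exact delsarteLasserre_block_flatten pad L i (by simpa using hi)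

/-- The word read off a block: `l ↦ b[l]`. On a block `List.ofFn w` it is `w`. [folklore] -/
theorem delsarteLasserre_read_ofFn {n : ℕ} (w : Fin n → Bool) : (fun l : Fin n => (List.ofFn w).getD l false) = w := by
  funext l
  rw [List.getD_eq_getElem _ _ (by rw [List.length_ofFn]; exact l.isLt), List.getElem_ofFn]

/-- **stmt-PneNP-2130** `CodeSizeLangInNEXP`: `L_code ∈ NEXP`. [cite: AroraBarak2009, §2.6.2] [cite: Papadimitriou1994, §20.1] -/
theorem delsarteLasserre_codeSizeLangInNEXP_proof : Summit.PneNP.PneNP.Theses.DelsarteLasserre.CodeSizeLangInNEXP := by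
  classical
  obtain ⟨τ, ⟨g, hg, hgspec⟩, hspec⟩ := delsarteLasserre_exists_codeTest
  set R : Language Bool := g ⁻¹' PRelSigma.HeadIs true with hR
  have hRP : R ∈ Classes.P := preimage_mem_P (PRelSigma.HeadIs_mem_P true) hg
  have hRsem : ∀ z : List Bool, z ∈ R ↔ τ z = true := by
    intro z
    change g z ∈ PRelSigma.HeadIs true ↔ _
    rw [PRelSigma.mem_HeadIs, show g z = g (strE z) from rfl, hgspec z]
    simp [bitE]
  unfold Summit.PneNP.PneNP.Theses.DelsarteLasserre.CodeSizeLangInNEXP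
  refine mem_NEXP_of_certificates hRP 1 1 ?_ ?_
  · -- completeness: list `K` words of a maximum independent set
    rintro x ⟨n, d, u, rfl, hK⟩
    set G : SimpleGraph (Fin n → Bool) := SimpleGraph.fromRel fun x y : Fin n → Bool => hammingDist x y < d with hG
    set K := bitsToNat u with hKdef
    obtain ⟨s, hs⟩ := G.exists_isNIndepSet_indepNum
    obtain ⟨t, hts, htK⟩ := Finset.exists_subset_card_eq (show K ≤ s.card by rw [hs.card_eq]; exact hK)
    have hlen : t.toList.length = K := by rw [Finset.length_toList, htK]
    have hnd : t.toList.Nodup := Finset.nodup_toList t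
    refine ⟨((t.toList.map fun w => List.ofFn w).flatten) ++ List.replicate K true, ?_, ?_⟩
    · -- length `K(n+1) ≤ 4ⁿ ≤ 2^{|x|}`
      rw [List.length_append, delsarteLasserre_length_flatten, hlen, List.length_replicate, pow_one, one_mul,
        length_boolPair, List.length_replicate]
      have hK2 : K ≤ 2 ^ n := by
        rw [← htK]
        have h := Finset.card_le_univ t
        rwa [Fintype.card_fun, Fintype.card_bool, Fintype.card_fin] at h
      have hn : n + 1 ≤ 2 ^ n := Nat.lt_two_pow_self
      calc K * n + K = K * (n + 1) := by ring
        _ ≤ 2 ^ n * 2 ^ n := Nat.mul_le_mul hK2 hn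
        _ = 2 ^ (2 * n) := by rw [← pow_add, two_mul]
        _ ≤ 2 ^ (2 * n + 2 + (boolPair (List.replicate d true) u).length) := Nat.pow_le_pow_right (by norm_num) (by omega)
        _ ≤ _ := Nat.le_succ _
    · rw [hRsem, hspec]
      simp only [fstF_boolPair, sndF_boolPair, List.length_replicate, List.length_append, delsarteLasserre_length_flatten,
        hlen]
      refine ⟨trivial, trivial, trivial, trivial, by omega, by nlinarith, fun i hi j hj hij => ?_⟩
      rw [← hKdef] at hi hj
      rw [delsarteLasserre_block_flatten _ _ i (by omega), delsarteLasserre_block_flatten _ _ j (by omega),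
        delsarteLasserre_count_eq_hammingDist, delsarteLasserre_read_ofFn, delsarteLasserre_read_ofFn]
      have hne : t.toList[i]'(by omega) ≠ t.toList[j]'(by omega) := by
        rw [Ne, hnd.getElem_inj_iff]
        exact hij.ne
      refine ⟨fun h => hne (List.ofFn_injective h), ?_⟩
      have hi' : t.toList[i]'(by omega) ∈ s := hts (Finset.mem_toList.1 (List.getElem_mem _))
      have hj' : t.toList[j]'(by omega) ∈ s := hts (Finset.mem_toList.1 (List.getElem_mem _))
      have hadj := hs.isIndepSet hi' hj' hne
      rw [hG, SimpleGraph.fromRel_adj] at hadj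
      exact not_lt.1 fun hlt => hadj ⟨hne, Or.inl hlt⟩
  · -- soundness: the blocks form an independent `K`-set
    intro x y hxy
    rw [hRsem, hspec] at hxy
    obtain ⟨h1, h2, h3, h4, h5, h6, h7⟩ := hxy
    refine ⟨(fstF x).length, (fstF (sndF x)).length, sndF (sndF x), ?_, ?_⟩
    · conv_lhs => rw [← h1, ← h2]
      rw [← h3, ← h4]
    · set n := (fstF x).length with hn
      set d := (fstF (sndF x)).length with hd
      set K := bitsToNat (sndF (sndF x)) with hK
      set G : SimpleGraph (Fin n → Bool) := SimpleGraph.fromRel fun x y : Fin n → Bool => hammingDist x y < d with hG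
      let w : ℕ → (Fin n → Bool) := fun i l => ((y.drop (i * n)).take n).getD l false
      -- blocks have length `n`
      have hblen : ∀ i, i < K → ((y.drop (i * n)).take n).length = n := by
        intro i hi
        rw [List.length_take, List.length_drop]
        have : (i + 1) * n ≤ K * n := Nat.mul_le_mul_right n hi
        rw [Nat.succ_mul] at this
        have h6' : n * K ≤ y.length := h6
        rw [mul_comm] at h6'
        omega
      -- distinct blocks, read as words, are distinct
      have hwne : ∀ i, i < K → ∀ j, j < K → i < j → w i ≠ w j := by
        intro i hi j hj hij heq
        apply (h7 i hi j hj hij).1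
        refine List.ext_getElem (by rw [hblen i hi, hblen j hj]) fun l hl₁ hl₂ => ?_
        have hl : l < n := by rw [hblen i hi] at hl₁; exact hl₁
        have := congrFun heq ⟨l, hl⟩
        simp only [w] at this
        rwa [List.getD_eq_getElem _ _ hl₁, List.getD_eq_getElem _ _ hl₂] at this
      have hinj : Set.InjOn w ↑(Finset.range K) := by
        intro i hi j hj heq
        rw [Finset.coe_range, Set.mem_Iio] at hi hj
        by_contra hne
        rcases lt_or_gt_of_ne hne with h | h
        · exact hwne i hi j hj h heq
        · exact hwne j hj i hi h heq.symm
      have hind : G.IsIndepSet ↑((Finset.range K).image w) := by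
        intro a ha b hb hab
        rw [Finset.coe_image, Finset.coe_range] at ha hb
        obtain ⟨i, hi, rfl⟩ := ha
        obtain ⟨j, hj, rfl⟩ := hb
        rw [Set.mem_Iio] at hi hj
        rw [hG, SimpleGraph.fromRel_adj, not_and_or]
        right
        rw [not_or, not_lt, not_lt]
        have hne : i ≠ j := fun h => hab (h ▸ rfl)
        rcases lt_or_gt_of_ne hne with h | h
        · have hle := (h7 i hi j hj h).2
          rw [delsarteLasserre_count_eq_hammingDist] at hle
          exact ⟨hle, by rwa [hammingDist_comm]⟩
        · have hle := (h7 j hj i hi h).2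
          rw [delsarteLasserre_count_eq_hammingDist] at hle
          exact ⟨by rwa [hammingDist_comm], hle⟩
      calc K = ((Finset.range K).image w).card := by rw [Finset.card_image_of_injOn hinj, Finset.card_range]
        _ ≤ G.indepNum := hind.card_le_indepNum

end Summit.PneNP.PneNP.Theorems
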